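import Summits.NavierStokesRegularity.NavierStokesRegularity.Theorems.ExtremiserTransienceNearExtremalTransienceExtremiserLiouvilleConstantSpeedBlowDownLimit
import HarnessLib

/-!
# Crux `ExtremiserTransience.NearExtremalTransience` (stmt-NavierStokesRegularity-21883), line `extremiser_liouville`,
# stub K1b — BLOW-DOWNS OF A RESIDUE JET CONCENTRATE (no strong `L²_loc` cluster point)

`--supports stmt-NavierStokesRegularity-21883` (helper).  Author: prover seat `ns-el-k1b` (g6).  The compactness half of
record §8 (N10′) settled NEGATIVELY for jets: let `(v, μ)` be a K1b residue (general frame) whose excess energy per unit length is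
bounded above AND below at large scales, `e₀ R ≤ ∫_{B_{R L₀}}‖v − c‖²` and `∫_{B_ρ}‖v − c‖² ≤ C ρ` (`R, ρ ≥ 1`; both hold for the
jet alternative by the slab-energy sandwich).  Then along NO sequence `Rₙ → ∞` do the blow-downs `V_{Rₙ} = Rₙ(v − c)(Rₙ·)`
converge strongly in `L²_loc`: a strong limit would vanish a.e. (`blowDown_limit_ae_eq_zero`) while
`‖V_{Rₙ}‖²_{L²(B_{L₀})} = Rₙ⁻¹ ∫_{B_{Rₙ L₀}}‖v − c‖² ≥ e₀` (`lintegral_ball_blowDown_sq`).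

* `blowDown_not_stronglyConvergent` : the statement above.

So the blow-down family of a jet CONCENTRATES (weakly to `0`, `…BlowDownWeakLimit`, with energy `≥ e₀` per unit length
collapsing onto the axis): the "extract a limit field and kill it" programme cannot close K1b; what it leaves is the defect measure
of the concentration.  WHAT THIS IS NOT: K1b is NOT proved; nothing here proves NS regularity. [folklore]
-/

noncomputable section

open Set Filter Topology MeasureTheory Metric Function
open scoped ENNReal NNReal Topology InnerProductSpace RealInnerProductSpace ContDiff
open Literature.Analysis.FluidPDE Literature.Analysis

namespace Summit.NavierStokesRegularity.NavierStokesRegularity.Theorems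

-- the problem directory repeats the summit name (`NavierStokesRegularity/NavierStokesRegularity`)
set_option linter.dupNamespace false

namespace ExtremiserLiouville

open DepletionLadder.KStar DepletionLadder.KStar.HalfSpace

variable {v : E3 → E3} {c : E3}

/-- **Blow-downs of a residue jet have no strong `L²_loc` cluster point.**  Residue `(v, μ)` as in `blowDown_limit_ae_eq_zero`
with two-sided linear excess-energy growth (`e₀ R ≤ ∫⁻_{B_{R L₀}}‖v − c‖ₑ²`, `∫⁻_{B_ρ}‖v − c‖ₑ² ≤ C ρ` for `R, ρ ≥ 1`, `e₀, L₀ > 0`),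
`Rₙ ≥ 1`, `Rₙ → ∞`: for NO measurable `U` do the blow-downs `x ↦ Rₙ(v(Rₙ x) − c)` converge to `U` in `L²_loc`.
(K1b itself is NOT proved here.) [folklore] -/
theorem blowDown_not_stronglyConvergent (hv : ContDiff ℝ ∞ v) (hdiv : VectorCalculus.IsDivFree v) {M : ℝ}
    (hM : ∀ x, ‖v x‖ = M) (h1 : ∫⁻ x, ‖iteratedFDeriv ℝ 1 v x‖ₑ ^ 2 < ⊤) (h2 : ∫⁻ x, ‖iteratedFDeriv ℝ 2 v x‖ₑ ^ 2 < ⊤)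
    (hpos : 0 < M * Real.sqrt (Zen v) * Real.sqrt (Wpa v))
    (μ : Measure E3) [IsFiniteMeasure μ]
    (hμ : ∀ ψ : E3 → E3, ContDiff ℝ ∞ ψ → HasCompactSupport ψ → VectorCalculus.IsDivFree ψ →
      Jst v * J1 v ψ - kStar ^ 2 * M ^ 2 * (Wpa v * A1 v ψ + Zen v * C1 v ψ) = ∫ x, ⟪v x, ψ x⟫_ℝ ∂μ)
    (hc : c ≠ 0) (hcM : ‖c‖ = M) (hL6 : MemLp (fun x => v x - c) 6 volume)
    {Cg : ℝ} (hCg : 0 ≤ Cg) (hgrowth : ∀ ρ : ℝ, 1 ≤ ρ → ∫⁻ x in ball (0 : E3) ρ, ‖v x - c‖ₑ ^ 2 ≤ ENNReal.ofReal (Cg * ρ))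
    {e₀ L₀ : ℝ} (he₀ : 0 < e₀) (hL₀ : 0 < L₀)
    (hlow : ∀ R : ℝ, 1 ≤ R → ENNReal.ofReal (e₀ * R) ≤ ∫⁻ x in ball (0 : E3) (R * L₀), ‖v x - c‖ₑ ^ 2)
    {Rn : ℕ → ℝ} (hRn1 : ∀ n, 1 ≤ Rn n) (hRn : Tendsto Rn atTop atTop)
    {U : E3 → E3} (hU : AEStronglyMeasurable U volume) :
    ¬ ∀ L : ℝ, 0 < L →
      Tendsto (fun n => ∫⁻ x in ball (0 : E3) L, ‖Rn n • (v (Rn n • x) - c) - U x‖ₑ ^ 2) atTop (𝓝 0) := by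
  intro hconv
  have hRn0 : ∀ n, 0 < Rn n := fun n => one_pos.trans_le (hRn1 n)
  -- the strong limit vanishes a.e.
  have hU0 : U =ᵐ[volume] 0 :=
    blowDown_limit_ae_eq_zero hv hdiv hM h1 h2 hpos μ hμ hc hcM hL6 hCg hgrowth hRn1 hRn hU hconv
  -- but the blow-downs keep energy `≥ e₀` in `B_{L₀}`
  have hge : ∀ n, ENNReal.ofReal e₀ ≤ ∫⁻ x in ball (0 : E3) L₀, ‖Rn n • (v (Rn n • x) - c) - U x‖ₑ ^ 2 := by
    intro n
    have hae : (fun x => ‖Rn n • (v (Rn n • x) - c) - U x‖ₑ ^ 2) =ᵐ[volume.restrict (ball (0 : E3) L₀)]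
        fun x => ‖Rn n • (v (Rn n • x) - c)‖ₑ ^ 2 := by
      filter_upwards [ae_restrict_of_ae hU0] with x hx
      rw [hx, Pi.zero_apply, sub_zero]
    rw [lintegral_congr_ae hae, lintegral_ball_blowDown_sq v c (hRn0 n) L₀]
    calc ENNReal.ofReal e₀ = ENNReal.ofReal (Rn n)⁻¹ * ENNReal.ofReal (e₀ * Rn n) := by
          rw [← ENNReal.ofReal_mul (inv_nonneg.2 (hRn0 n).le), ← mul_assoc, mul_comm (Rn n)⁻¹, mul_assoc,
            inv_mul_cancel₀ (hRn0 n).ne', mul_one]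
      _ ≤ ENNReal.ofReal (Rn n)⁻¹ * ∫⁻ x in ball (0 : E3) (Rn n * L₀), ‖v x - c‖ₑ ^ 2 := mul_le_mul' le_rfl (hlow (Rn n) (hRn1 n))
  have hle : ENNReal.ofReal e₀ ≤ 0 := ge_of_tendsto' (hconv L₀ hL₀) hge
  exact absurd (le_antisymm hle bot_le) (ENNReal.ofReal_pos.2 he₀).ne'

end ExtremiserLiouville

end Summit.NavierStokesRegularity.NavierStokesRegularity.Theorems

end
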